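import Literature.AnabelianGeometry.EtaleTheta.TemperedFrobenioidGenuineWeakPiNat
import Literature.AlgebraicGeometry.Frobenioids.ModelFrobenioidMap
import HarnessLib

/-!
# [EtTh] Def. 3.6 (ii), monoid type `Λ = ℝ`: a tempered Frobenioid over the WEAK `ℝ`-realified data at
# `Φ₀ = ∏_ℕ ℤ_{≥0}` (infinitely many special-fibre components) — non-vacuity witness

S. Mochizuki, *The étale theta function and its Frobenioid-theoretic manifestations*, Publ. RIMS **45** (2009),
Def. 3.6 (i)/(ii) pp.76–77 ("`Λ ∈ {ℤ, ℚ, ℝ}` … `B₀^ℝ := ℝ·Φ₀^birat`, `F₀^ℝ := ℝ·Φ₀^cnst`")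
[cite: MochizukiEtTh2009, Def 3.6 p.77].

abc-iut cell, layer L2, seat abc-iut-L2-d2 (gen 4), row «NV-L2/TemperedFrobenioid-WEAK-∞» (abc-iut-L2-lead gen 4
R227/R300), `Λ = ℝ` companion of `TemperedFrobenioidGenuineWeakPiNat.lean` (model-construction file, class (b)).
Over abc-iut-L6-t12's `ofRlfRWeak WeakPiNat.divisorMonoids _` (`B₀^ℝ = ℝ·Φ₀^birat`, `F₀^ℝ = ℝ·Φ₀^cnst ∩ B₀^ℝ`,
`B₀^ℝ → (Φ₀^ℝ)^gp` the inclusion) the SAME divisor monoid `Φ := im(Φ₀^pf → Φ₀^rlf)` as at `Λ = ℤ` satisfies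
Def. 3.6 (ii): `Φ^{ℝ-log}`, `Φ₀ → Φ₀^ℝ`, `ℝ·Φ₀^cnst` and the (non-)cuspidal parts of `ofRlfRWeak` coincide with those
of `ofRlfZWeak` (`rfl`), so group-saturation, weak perf-factoriality, divisoriality and (a)
"`Φ^{bs-fld} = ι(⟨d⟩^pf)` monoprime" are the `Λ = ℤ` theorems verbatim; (b) is witnessed by the constant
`[ι(d)] ∈ ℝ·Φ₀^cnst ∩ ℝ·Φ₀^birat = F₀^ℝ`, whose image in `(Φ₀^ℝ)^gp` is `ι(d)/1`, `ι(d) ≠ 1`: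

* `WeakPiNat.realifiedR := ofRlfRWeak divisorMonoids _`;
* `WeakPiNat.genuineTemperedFrobenioidR R S : TemperedFrobenioid realifiedR (Discrete PUnit) (treeCatVocab …)`;
* `nonempty_temperedFrobenioid_weakR_piNat`.

HONEST LABEL: GENUINE weak/realification/[FrdI] vocabularies; DEGENERATE geometry (one object, no cusps, constant
functions only); an instantiation witness, NOT the realified tempered Frobenioid of a curve.  No statement of
the paper is asserted; nothing here bears on [IUTchIII] Cor. 3.12.  Typed ≠ proved.
-/

noncomputable section

namespace Literature.AnabelianGeometry.EtaleTheta

open CategoryTheory Opposite Literature.AlgebraicGeometry.Frobenioids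

namespace WeakPiNat

/-- The Def. 3.6 (i) data for `Λ = ℝ` CONSTRUCTED over the weak vocabulary (abc-iut-L6-t12's `ofRlfRWeak`) at the
datum `Φ₀ = ∏_ℕ ℤ_{≥0}`, `B₀ = ϖ^ℤ`: `Φ₀^ℝ = (∏_ℕ ℤ_{≥0})^rlf`, `B₀^ℝ = ℝ·Φ₀^birat`, `F₀^ℝ = ℝ·Φ₀^cnst`.
[cite: MochizukiEtTh2009, Def 3.6 p.76] -/
abbrev realifiedR : RealifiedDivisorMonoids (D₀ := Discrete PUnit.{1}) treeMonoidVocabWeak.{0} :=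
  RealifiedDivisorMonoids.ofRlfRWeak divisorMonoids isPerfFactorialCof_Φ₀

/-- `[ι(d)] ∈ ℝ·Φ₀^birat(Y)` (`[d] = div₀(ϖ) ∈ Φ₀^birat`, and `ι^gp(Φ₀^birat) ⊆ ℝ·Φ₀^birat`).
[cite: MochizukiEtTh2009, Def 3.6 p.76] -/
theorem of_toRealification_diag_mem_realSpan_biratGp (Y : (Discrete PUnit.{1})ᵒᵖ) :
    Algebra.GrothendieckGroup.of ((isPerfFactorialCof_Φ₀ Y).weak.toRealification (Perfection.of _ diag)) ∈
      ((RealifiedDivisorMonoids.realDataWeak divisorMonoids isPerfFactorialCof_Φ₀).realSpan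
        divisorMonoids.biratGp).carrier (unop Y) := by
  have h := (RealifiedDivisorMonoids.realDataWeak divisorMonoids isPerfFactorialCof_Φ₀).toRlfGp_mem_realSpan
    divisorMonoids.biratGp (unop Y)
    (Subgroup.subset_closure ⟨Multiplicative.ofAdd (1 : ℤ), divHom_ofAdd_one⟩ :
      Algebra.GrothendieckGroup.of diag ∈ divisorMonoids.biratGp.carrier (unop Y))
  rw [show ((RealifiedDivisorMonoids.realDataWeak divisorMonoids isPerfFactorialCof_Φ₀).toRlfGp (unop Y)
      (Algebra.GrothendieckGroup.of diag) : Algebra.GrothendieckGroup (isPerfFactorialCof_Φ₀ Y).weak.Rlf) =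
    Algebra.GrothendieckGroup.of ((isPerfFactorialCof_Φ₀ Y).weak.toRealification (Perfection.of _ diag)) from
    MonGp.map_of _ _] at h
  exact h

/-- `[ι(d)] ∈ ℝ·Φ₀^cnst(Y)` (`Φ₀^cnst ⊆ ℝ·Φ₀^cnst`, `div₀(ϖ) = [d]`). [cite: MochizukiEtTh2009, Def 3.6 p.76] -/
theorem of_toRealification_diag_mem_cnstR (Y : (Discrete PUnit.{1})ᵒᵖ) :
    Algebra.GrothendieckGroup.of ((isPerfFactorialCof_Φ₀ Y).weak.toRealification (Perfection.of _ diag)) ∈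
      realifiedR.cnstR Y := by
  have key := realifiedR.cnst_le_cnstR Y (Multiplicative.ofAdd (1 : ℤ)) (Submonoid.mem_top _)
  have hb : realifiedR.div₀ Y (Multiplicative.ofAdd (1 : ℤ)) =
      (Algebra.GrothendieckGroup.of diag : Algebra.GrothendieckGroup (realifiedR.Φ₀.obj Y)) :=
    divHom_ofAdd_one
  rw [hb, EtaleTheta.gpMap_of] at key
  exact key

variable (R S : ((Discrete PUnit.{1})ᵒᵖ ⥤ CommMonCat.{0}) → Prop)

/-- **Def. 3.6 (ii) data of monoid type `ℝ` over the WEAK vocabulary at infinitely many special-fibre components**: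
the tempered Frobenioid structure on `(D := Discrete PUnit → D₀, Φ := im(Φ₀^pf → Φ₀^rlf))` over
`ofRlfRWeak WeakPiNat.divisorMonoids _` and the genuine category vocabulary `treeCatVocab` — the `Λ = ℤ` proofs of
`genuineTemperedFrobenioid` verbatim for every clause but (b), which is witnessed by `[ι(d)] ∈ F₀^ℝ = ℝ·Φ₀^cnst ∩ ℝ·Φ₀^birat`
with image `ι(d)/1` in `(Φ₀^ℝ)^gp`. [cite: MochizukiEtTh2009, Def 3.6 p.77] -/
def genuineTemperedFrobenioidR :
    TemperedFrobenioid realifiedR (Discrete PUnit.{1}) (treeCatVocab (Discrete PUnit.{1}) R S) where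
  isConnected := Toy.temperedFrobenioid.isConnected
  isTotallyEpimorphic := Toy.temperedFrobenioid.isTotallyEpimorphic
  base := 𝟭 _
  Φ := genuineΦ
  isGroupSaturated A := PfImageWeak.isGroupSaturated_mrange_toRealification (isPerfFactorialCof_Φ₀ A).weak
  isPerfFactorial A := PfImageWeak.isPerfFactorialCof_mrange_toRealification (isPerfFactorialCof_Φ₀ A)
  isDivisorialOn := by
    rw [treeCatVocab_isDivisorialOn]
    exact ⟨Cor38Toy.isMonoidOn_of_punit _,
      fun A => PfImageWeak.isDivisorial_mrange_toRealification (isPerfFactorialCof_Φ₀ (op A))⟩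
  isMonoprime_bsFld A := isMonoprime_bsFld A
  exists_FΛ_div_ne A :=
    ⟨⟨Algebra.GrothendieckGroup.of ((isPerfFactorialCof_Φ₀ A).weak.toRealification (Perfection.of _ diag)),
        of_toRealification_diag_mem_realSpan_biratGp A⟩,
      of_toRealification_diag_mem_cnstR A,
      (isPerfFactorialCof_Φ₀ A).weak.toRealification (Perfection.of _ diag), ⟨_, rfl⟩, 1, one_mem _,
      toRealification_of_diag_ne_one A, by rw [map_one, div_one]; rfl⟩

/-- `Φ` of the `Λ = ℝ` witness is `pfImage`. [cite: MochizukiEtTh2009, Def 3.6 p.77] -/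
@[simp] theorem genuineTemperedFrobenioidR_Φ_carrier (A : (Discrete PUnit.{1})ᵒᵖ) :
    (genuineTemperedFrobenioidR R S).Φ.carrier A = pfImage A := rfl

/-- **Def. 3.6 (ii) of monoid type `ℝ` over the WEAK vocabulary is INHABITED at `Φ₀ = ∏_ℕ ℤ_{≥0}`.**
[cite: MochizukiEtTh2009, Def 3.6 p.77] -/
theorem nonempty_temperedFrobenioid_weakR_piNat :
    Nonempty (TemperedFrobenioid realifiedR (Discrete PUnit.{1}) (treeCatVocab (Discrete PUnit.{1}) R S)) :=
  ⟨genuineTemperedFrobenioidR R S⟩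

end WeakPiNat

end Literature.AnabelianGeometry.EtaleTheta

end
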